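import Literature.Probability.LatticeModels.SixVertexObservables
import Literature.LinearAlgebra.Matrix.TransferMatrixSpectralWeights

/-!
# Six-vertex model: cylinder expectations of strip observables (eq. (cylop)), reflection
# symmetry (Cor. 56 (4)) and the spectral representation of general observables
# (DKLM 2026, Theorem 26)

H. Duminil-Copin, K. K. Kozlowski, P. Lammers, I. Manolescu, *Gaussian free field convergence of
the six-vertex model with `-1 ≤ Δ ≤ -1/2`*, arXiv:2603.06268 (2026) [DKLM2026SixVertexGFF]
(`paper:arxiv-2603.06268`, §4.5.3 = chunk p0019, Part III §1–2 = chunks p0040–p0042):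

> **Theorem 26** (Spectral representation of general observables). Fix `c > 0`. For any triple
> `(X, Y, L) ∈ 𝔄⁻ × 𝔄⁺ × 2ℤ_{≥1}`, there exists a finite complex-valued measure `μ_{X,Y,L}`
> supported on `[0, 2)` such that:
> (i) For any `k ≥ 0`, `𝔼_{CYL_L}[X · τ_{(k,0)}(Y)] = ∫ (1-a)^k dμ_{X,Y,L}(a)`,
> (ii) (Cauchy–Schwarz inequality) `μ_{X,X†,L}` and `μ_{Y†,Y,L}` are positive measures and
> `|𝔼_{CYL_L}[XY]|² ≤ ‖μ_{X,Y,L}‖² ≤ ‖μ_{X,X†,L}‖ · ‖μ_{Y†,Y,L}‖ = 𝔼_{CYL_L}[XX†] 𝔼_{CYL_L}[Y†Y]`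
> where `‖·‖` denotes the total variation metric.
>
> **Corollary 56.** (3) *Torus measure.* `Z ℙ[{balanced}] 𝔼[X | {balanced}] = Trace 𝔬_X^{0M}`.
> (4) *Reflection symmetry.* `(𝔬_X^{ii'})† = 𝔬_{X†}^{(-i')(-i)}`. […]
> (eq. (cylop)) `𝔼_{CYL_L}[X] = lim_{M→∞} ℙ_{𝕋_{M,L}}[X | {balanced}]
>   = lim_{M→∞} Trace(𝔬_X t^{M-(i'-i)}) / Trace t^M = v_0† 𝔒_X v_0.`
> *Proof of Theorem 26.* […] Step 1: `μ_{X,Y,L} := ∑_k (ℰ⁺(Y) v_k)(v_k† ℰ⁻(X)) δ_{1-Λ_k(π/2)}`.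
> Step 2 (composition rule + shift invariance): `𝔼_{CYL_L}[X · τ_{(n,0)}(Y)] = ℰ⁺(Y) T(π/2)^n ℰ⁻(X)`.
> Step 3 (reflection symmetry): `ℰ⁺(X†) = (ℰ⁻(X))†`, positivity, Cauchy–Schwarz.

This file carries out Part III §1 (eq. (cylop)) and §2 (Theorem 26) for the objects of
`SixVertexCylinderLimit.lean` / `SixVertexObservables.lean` (isotropic weights `a = b = 1`, any
`c > 0`, torus `ZMod M × G₂`, balanced column states `𝔅`, transfer matrix `t_𝔅 = t(π/2)`), with
the linear algebra of `Literature/LinearAlgebra/Matrix/TransferMatrixSpectralWeights.lean`: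

1. **Free columns and the reflection** (generic strip observables): `freeObs`, `obsMatrix_freeObs`
   (`𝔬_1 = t^{k'+1}`), `obsMatrix_tensorObs_freeObs_tensorObs` (`𝔬_{X ⊠ 1 ⊠ Y} = 𝔬_X t^{k'+1} 𝔬_Y`,
   Step 2 at the operator level), the reflected observable `reflectObs X = X†` (Remark 24: the
   reflection acts on height functions, so horizontal arrows keep and vertical arrows reverse
   their orientation) and **`obsMatrix_reflectObs`: `𝔬_{X†} = (𝔬_X)ᵀ`** for any column weight
   invariant under (west ↔ east, verticals reversed) — Corollary 56 (4), which holds for the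
   six-vertex weights at `a = b` (`columnWeight_swap`).
2. **Conditional torus expectations** `torusCondExp` (`𝔼_{𝕋}[F | balanced]`,
   `torusCondProb_eq_torusCondExp`), strip observables in column-state form on `ℓ²(𝔅)`
   (`balObs`, `balObsMatrix = 𝔬_X`, `balObsMatrix_reflectObs`), and **Corollary 56 (3) for
   observables**: `sum_ite_isBalanced_obs_eq_trace`, `torusCondExp_eq_trace_div_trace`
   (`𝔼_{𝕋_{M,L}}[X | balanced] = Trace(𝔬_X t^{s+1}) / Trace(t^M)`).
3. **eq. (cylop) / Lemma 22 for observables**: `torusObs` (reading a strip observable on the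
   torus), `torusObsExp`, `exists_tendsto_torusObsExp`, **`cylinderObsExp = 𝔼_{CYL_L}[X]`**
   (`limUnder`), `tendsto_cylinderObsExp`, and `cylinderObsExp_eq`:
   `𝔼_{CYL_L}[X] = (∑_{i : λ_i = Λ} (Uᵀ 𝔬_X U)_{ii}) / (d Λ^{r'+1})` — the paper's `v_0† 𝔒_X v_0`
   when the top eigenvalue is simple; here, as in `SixVertexCylinderLimit.lean`, no
   Perron–Frobenius non-degeneracy is used: the top eigenspace (dimension `d`) is averaged, and
   `-Λ` is excluded by positivity of the diagonal of `t_𝔅`.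
4. **Theorem 26.** `spectralAtom c j = a_j = 1 - λ_j/Λ ∈ [0, 2)` (`spectralAtom_mem_Ico`) and
   `spectralWeight c X Y j = c_j(X, Y)`, the atoms and weights of
   `μ_{X,Y,L} = ∑_j c_j(X,Y) δ_{a_j}` (a finite family indexed by `𝔅`; the measure itself is
   this finite sum of Dirac masses and is not introduced as a separate object);
   (i) `tendsto_trace_obs_pow_obs_pow_div` (operator level), `torusPairObs` / `torusPairExp`
   (`𝔼_{𝕋_{M,L}}[X · τ_{(n,0)} Y | balanced]`), `torusPairExp_eq_trace_div_trace` (Step 2 on the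
   torus), **`tendsto_torusPairExp`** and **`cylinderPairExp_eq_sum`**:
   `𝔼_{CYL_L}[X · τ_{(r₁'+1+k, 0)} Y] = ∑_j c_j(X,Y) (1 - a_j)^k` for every `k ≥ 0`
   (`X` on the vertex columns `0..r₁'`, i.e. `X ∈ 𝔄⁻` for the reflection line between the
   columns `r₁'` and `r₁'+1`; `Y ∈ 𝔄⁺` starting at column `r₁'+1`, shifted by `k`);
   (ii) **`spectralWeight_reflectObs_nonneg`** (`μ_{X,X†,L}`, `μ_{Y†,Y,L}` are positive),
   **`sq_sum_abs_spectralWeight_le`** (`‖μ_{X,Y,L}‖² ≤ ‖μ_{X,X†,L}‖ ‖μ_{Y†,Y,L}‖`, with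
   `‖μ‖ ≤ ∑_j |c_j|`, equality when the atoms are distinct), `abs_sum_spectralWeight_le`
   (`|𝔼[XY]| ≤ ‖μ_{X,Y,L}‖`) and `cylinderPairExp_eq_sum_zero` (`𝔼_{CYL_L}[XY] = ∑_j c_j(X,Y)`, so
   that `‖μ_{X,X†,L}‖ = 𝔼_{CYL_L}[XX†]`).

Faithfulness notes. The source's local observables `𝔄^±` are functions of the height function on
finitely many faces left/right of the line `𝔩`; for fixed `L` these are functions of the arrows
in finitely many columns, which is the notion of strip observable used here (incoming horizontal
arrows, `r'+1` columns of horizontal and vertical arrows). The source's matrices act on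
`Ω = ℓ²(𝔅)` by `e_{κ'}† 𝔬 e_κ`; the matrices here are indexed `(incoming, outgoing)`, i.e. are
the transposes, so compositions appear in the opposite order (`obsMatrix_tensorObs`). Everything
is real (`a = b = 1`), so `†` is the transpose.

## References

* H. Duminil-Copin, K. K. Kozlowski, P. Lammers, I. Manolescu, arXiv:2603.06268 (2026), §4.5.3
  (Remark 24, Theorem 26), Part III §1 (Cor. 56, Lemma 57, Remark 58, eq. (cylop)) and §2 (proof
  of Theorem 26, Steps 1–3). [DKLM2026SixVertexGFF]
-/

noncomputable section

open Finset Matrix Filter Topology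
open Literature.LinearAlgebra.Matrix

namespace Literature.Probability.LatticeModels.SixVertex

/-! ## 0. Generic strip observables: free columns, concatenation with a gap, reflection -/

section ObsFree

variable {S V R : Type*} [Fintype S] [DecidableEq S] [Fintype V] [CommSemiring R]

/-- The trivial observable `1` on `k' + 1` free columns. [cite: DKLM2026SixVertexGFF, Cor. 56 (1)] -/
def freeObs (S V R : Type*) [One R] (k' : ℕ) : S → (Fin (k' + 1) → S) → (Fin (k' + 1) → V) → R :=
  fun _ _ _ => 1

/-- **`𝔬_1 = t^{k'+1}`** on `k' + 1` free columns (Cor. 56 (1)–(2): the operator of the empty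
observable on a strip is the power of the one-step transfer matrix).
[cite: DKLM2026SixVertexGFF, Cor. 56 (1)–(2)] -/
theorem obsMatrix_freeObs (k' : ℕ) (w : S → S → V → R) :
    obsMatrix k' w (freeObs S V R k') = colMatrix w ^ (k' + 1) := by
  ext i j
  rw [pow_succ_apply_eq_sum_paths]
  simp only [obsMatrix, freeObs, Matrix.of_apply, one_mul]
  refine Finset.sum_congr rfl fun q _ => ?_
  simp only [colMatrix, Matrix.of_apply]
  rw [Finset.prod_univ_sum, Fintype.piFinset_univ]

/-- The operator of `X` followed by `k' + 1` free columns: `𝔬_{X ⊠ 1} = 𝔬_X t^{k'+1}`.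
[cite: DKLM2026SixVertexGFF, Cor. 56 (2)] -/
theorem obsMatrix_tensorObs_freeObs {r₁' : ℕ} (k' : ℕ) (w : S → S → V → R)
    (X : S → (Fin (r₁' + 1) → S) → (Fin (r₁' + 1) → V) → R) :
    obsMatrix (r₁' + 1 + k') w (tensorObs X (freeObs S V R k')) =
      obsMatrix r₁' w X * colMatrix w ^ (k' + 1) := by
  rw [obsMatrix_tensorObs, obsMatrix_freeObs]

/-- **Step 2 of the proof of Theorem 26 at the operator level**: the operator of
`X ⊠ 1_{k'+1} ⊠ Y` (`X`, then `k' + 1` free columns, then `Y`) is `𝔬_X t^{k'+1} 𝔬_Y`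
(composition rule twice). [cite: DKLM2026SixVertexGFF, Part III §2, Step 2] -/
theorem obsMatrix_tensorObs_freeObs_tensorObs {r₁' r₂' : ℕ} (k' : ℕ) (w : S → S → V → R)
    (X : S → (Fin (r₁' + 1) → S) → (Fin (r₁' + 1) → V) → R)
    (Y : S → (Fin (r₂' + 1) → S) → (Fin (r₂' + 1) → V) → R) :
    obsMatrix (r₁' + 1 + k' + 1 + r₂') w (tensorObs (tensorObs X (freeObs S V R k')) Y) =
      obsMatrix r₁' w X * colMatrix w ^ (k' + 1) * obsMatrix r₂' w Y := by
  rw [obsMatrix_tensorObs, obsMatrix_tensorObs_freeObs]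

end ObsFree

section Reflect

variable {S G R : Type*} [Fintype S] [DecidableEq S] [Fintype G] [DecidableEq G] [CommSemiring R]

/-- **The reflected strip observable `X†`** (reflection of the strip in a vertical line, acting
on height functions, Remark 24: horizontal arrows keep their orientation, vertical arrows are
reversed): `X†(i, κ, α) = X(κ_{r'}, (κ_{r'-1}, …, κ_0, i), x ↦ ¬α_{r'-x})`.
[cite: DKLM2026SixVertexGFF, §4.5.3 (the reflection `†`) and Cor. 56 (4)] -/
def reflectObs {r' : ℕ} (X : S → (Fin (r' + 1) → S) → (Fin (r' + 1) → G → Bool) → R) :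
    S → (Fin (r' + 1) → S) → (Fin (r' + 1) → G → Bool) → R :=
  fun i κ α => X (κ (Fin.last r'))
    (fun x => (Fin.cons i κ : Fin (r' + 2) → S) (Fin.rev x).castSucc) (fun x y => !(α (Fin.rev x) y))

omit [Fintype S] [DecidableEq S] [Fintype G] [DecidableEq G] in
/-- Reversing a glued strip: `cons j (snoc (κ' ∘ rev) i) z = cons i (snoc κ' j) (rev z)`.
[folklore] -/
theorem cons_snoc_rev_apply {r' : ℕ} (i j : S) (κ' : Fin r' → S) (z : Fin (r' + 2)) :
    (Fin.cons j (Fin.snoc (fun m => κ' (Fin.rev m)) i : Fin (r' + 1) → S) : Fin (r' + 2) → S) z =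
      (Fin.cons i (Fin.snoc κ' j : Fin (r' + 1) → S) : Fin (r' + 2) → S) (Fin.rev z) := by
  induction z using Fin.cases with
  | zero =>
    rw [Fin.rev_zero, Fin.cons_zero, ← Fin.succ_last, Fin.cons_succ, Fin.snoc_last]
  | succ x =>
    rw [Fin.cons_succ, Fin.rev_succ]
    induction x using Fin.lastCases with
    | last => rw [Fin.snoc_last, Fin.rev_last, Fin.castSucc_zero, Fin.cons_zero]
    | cast m =>
      rw [Fin.snoc_castSucc, Fin.rev_castSucc, ← Fin.succ_castSucc, Fin.cons_succ,
        Fin.snoc_castSucc]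

omit [Fintype S] [DecidableEq S] [Fintype G] [DecidableEq G] in
/-- The reflected column states of a glued strip form the reversed strip. [folklore] -/
theorem cons_snoc_rev_castSucc_eq {r' : ℕ} (i j : S) (κ' : Fin r' → S) :
    (fun x : Fin (r' + 1) =>
        (Fin.cons i (Fin.snoc κ' j : Fin (r' + 1) → S) : Fin (r' + 2) → S) (Fin.rev x).castSucc) =
      (Fin.snoc (fun m => κ' (Fin.rev m)) i : Fin (r' + 1) → S) := by
  funext x
  rw [show (Fin.rev x).castSucc = Fin.rev x.succ from (Fin.rev_succ x).symm,
    ← cons_snoc_rev_apply i j κ' x.succ, Fin.cons_succ]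

omit [DecidableEq S] in
/-- **Corollary 56 (4), reflection symmetry**: for a column weight invariant under exchanging
the west/east states and reversing the vertical arrows (the six-vertex weights at `a = b`,
`columnWeight_swap`), the operator of the reflected observable is the transpose:
`𝔬_{X†} = (𝔬_X)ᵀ`. [cite: DKLM2026SixVertexGFF, Cor. 56 (4)] -/
theorem obsMatrix_reflectObs {r' : ℕ} (w : S → S → (G → Bool) → R)
    (hw : ∀ i j β, w i j β = w j i (fun y => !β y))
    (X : S → (Fin (r' + 1) → S) → (Fin (r' + 1) → G → Bool) → R) :
    obsMatrix r' w (reflectObs X) = (obsMatrix r' w X)ᵀ := by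
  ext i j
  simp only [obsMatrix, Matrix.transpose_apply, Matrix.of_apply]
  refine Fintype.sum_bijective (fun κ' : Fin r' → S => fun m => κ' (Fin.rev m))
    (Function.Involutive.bijective fun κ' => funext fun m => by simp [Fin.rev_rev]) _ _
    fun κ' => ?_
  refine Fintype.sum_bijective
    (fun α' : Fin (r' + 1) → G → Bool => fun x y => !(α' (Fin.rev x) y))
    (Function.Involutive.bijective fun α' => funext fun x => funext fun y => by
      simp [Fin.rev_rev]) _ _ fun α' => ?_
  dsimp only
  congr 1
  · -- the observable
    simp only [reflectObs, Fin.snoc_last, cons_snoc_rev_castSucc_eq]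
  · -- the weights: reverse the path
    symm
    calc (∏ m : Fin (r' + 1),
          w ((Fin.cons j (Fin.snoc (fun m => κ' (Fin.rev m)) i : Fin (r' + 1) → S) :
                Fin (r' + 2) → S) m.castSucc)
            ((Fin.cons j (Fin.snoc (fun m => κ' (Fin.rev m)) i : Fin (r' + 1) → S) :
                Fin (r' + 2) → S) m.succ)
            (fun y => !(α' (Fin.rev m) y)))
        = ∏ m : Fin (r' + 1),
            w ((Fin.cons i (Fin.snoc κ' j : Fin (r' + 1) → S) : Fin (r' + 2) → S)
                (Fin.rev m).castSucc)
              ((Fin.cons i (Fin.snoc κ' j : Fin (r' + 1) → S) : Fin (r' + 2) → S) (Fin.rev m).succ)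
              (α' (Fin.rev m)) := by
          refine Finset.prod_congr rfl fun m _ => ?_
          rw [cons_snoc_rev_apply, cons_snoc_rev_apply, Fin.rev_castSucc, Fin.rev_succ,
            hw (_ : S) _ (α' (Fin.rev m))]
      _ = ∏ m : Fin (r' + 1),
            w ((Fin.cons i (Fin.snoc κ' j : Fin (r' + 1) → S) : Fin (r' + 2) → S) m.castSucc)
              ((Fin.cons i (Fin.snoc κ' j : Fin (r' + 1) → S) : Fin (r' + 2) → S) m.succ) (α' m) :=
          Fintype.prod_bijective Fin.rev Fin.rev_bijective _ _ fun m => rfl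

end Reflect

/-! ## 1. Conditional torus expectations of real observables -/

section CondExp

variable {G₁ G₂ : Type*} [AddGroup G₁] [AddGroup G₂] [One G₁] [One G₂] [Fintype G₁] [Fintype G₂]
  [DecidableEq G₁] [DecidableEq G₂]

open scoped Classical in
/-- **`𝔼_{𝕋}[F | balanced]`** `= (∑_{ω balanced} F(ω) W(ω)) / (∑_{ω balanced} W(ω))`, the
conditional expectation of a real observable under the balanced torus six-vertex measure
(`x / 0 = 0` if there is no balanced configuration of positive weight).
[cite: DKLM2026SixVertexGFF, Def. 2.1 and Cor. 56 (3)] -/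
def torusCondExp (a b c : ℝ) (F : Config (G₁ × G₂) → ℝ) : ℝ :=
  (∑ ω : Config (G₁ × G₂), if IsBalanced ω then F ω * torusWeight a b c ω else 0) /
    ∑ ω : Config (G₁ × G₂), if IsBalanced ω then torusWeight a b c ω else 0

open scoped Classical in
/-- Conditional probabilities are conditional expectations of indicators. [folklore] -/
theorem torusCondProb_eq_torusCondExp (a b c : ℝ) (A : Set (Config (G₁ × G₂))) :
    torusCondProb a b c A = torusCondExp a b c (fun ω => if ω ∈ A then 1 else 0) := by
  unfold torusCondProb torusCondExp
  simp only [Finset.sum_filter]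
  congr 1
  refine Finset.sum_congr rfl fun ω _ => ?_
  by_cases hb : IsBalanced ω <;> by_cases hA : ω ∈ A <;> simp [hb, hA]

end CondExp

/-! ## 2. Reading strip observables on the torus `ZMod M × G₂` -/

section Reading

variable {G₂ : Type*}

/-- **Reading a strip observable on the torus** `ZMod M × G₂`: the incoming state is the
column `-1 = M - 1` of horizontal arrows, the strip consists of the columns `0, …, r'`.
[cite: DKLM2026SixVertexGFF, Part III §1] -/
def torusObs {M : ℕ} (r' : ℕ)
    (X : (G₂ → Bool) → (Fin (r' + 1) → G₂ → Bool) → (Fin (r' + 1) → G₂ → Bool) → ℝ)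
    (ω : Config (ZMod M × G₂)) : ℝ :=
  X (fun y => (ω (-1, y)).1) (fun k y => (ω (((k : ℕ) : ZMod M), y)).1)
    (fun k y => (ω (((k : ℕ) : ZMod M), y)).2)

/-- Natural-number casts into `ZMod (N+1) = Fin (N+1)` by value. [folklore] -/
theorem natCast_zmod_eq_of_val_eq {N : ℕ} (m : ℕ) (x : Fin (N + 1)) (h : x.val = m) :
    ((m : ℕ) : ZMod (N + 1)) = x := by
  apply Fin.ext
  show ZMod.val ((m : ℕ) : ZMod (N + 1)) = x.val
  rw [ZMod.val_natCast, h]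
  exact Nat.mod_eq_of_lt (h ▸ x.2)

/-- `-1` is the last column index. [folklore] -/
theorem neg_one_zmod_eq_natAdd_last (r' s' : ℕ) :
    (-1 : ZMod (r' + 1 + (s' + 1))) = Fin.natAdd (r' + 1) (Fin.last s') := by
  apply Fin.ext
  show ZMod.val (-1 : ZMod (r' + 1 + s').succ) = (Fin.natAdd (r' + 1) (Fin.last s')).val
  rw [ZMod.val_neg_one]
  simp

/-- The torus reading of a strip observable on the glued torus `ZMod (r'+1+(s'+1)) × G₂` in
`Fin`-block coordinates. [folklore] -/
theorem torusObs_eq (r' s' : ℕ)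
    (X : (G₂ → Bool) → (Fin (r' + 1) → G₂ → Bool) → (Fin (r' + 1) → G₂ → Bool) → ℝ)
    (ω : Config (ZMod (r' + 1 + (s' + 1)) × G₂)) :
    torusObs r' X ω = X (fun y => (ω (Fin.natAdd (r' + 1) (Fin.last s'), y)).1)
      (fun k y => (ω (Fin.castAdd (s' + 1) k, y)).1) (fun k y => (ω (Fin.castAdd (s' + 1) k, y)).2) := by
  unfold torusObs
  rw [neg_one_zmod_eq_natAdd_last]
  simp only [natCast_zmod_eq_castAdd]

variable [AddGroup G₂]

/-- **The pair observable `X · τ_{(n,0)} Y` read on the torus**: `X` on the columns `0, …, r₁'`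
(incoming column `-1`) and `Y` on the strip starting at column `n` (incoming column `n - 1`).
[cite: DKLM2026SixVertexGFF, Theorem 26 (i)] -/
def torusPairObs {M : ℕ} (r₁' : ℕ)
    (X : (G₂ → Bool) → (Fin (r₁' + 1) → G₂ → Bool) → (Fin (r₁' + 1) → G₂ → Bool) → ℝ) (n : ℕ)
    (r₂' : ℕ) (Y : (G₂ → Bool) → (Fin (r₂' + 1) → G₂ → Bool) → (Fin (r₂' + 1) → G₂ → Bool) → ℝ)
    (ω : Config (ZMod M × G₂)) : ℝ :=
  torusObs r₁' X ω * torusObs r₂' Y (fun v => ω (v + (((n : ℕ) : ZMod M), 0)))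

/-- Reading `X · τ_{(r₁'+1, 0)} Y` (no gap) on the glued torus: it is the concatenation `X ⊠ Y`.
[folklore] -/
theorem torusPairObs_eq_tensorObs {r₁' r₂' : ℕ} (s' : ℕ)
    (X : (G₂ → Bool) → (Fin (r₁' + 1) → G₂ → Bool) → (Fin (r₁' + 1) → G₂ → Bool) → ℝ)
    (Y : (G₂ → Bool) → (Fin (r₂' + 1) → G₂ → Bool) → (Fin (r₂' + 1) → G₂ → Bool) → ℝ)
    (ω : Config (ZMod (r₁' + 1 + r₂' + 1 + (s' + 1)) × G₂)) :
    torusPairObs r₁' X (r₁' + 1) r₂' Y ω =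
      tensorObs X Y (fun y => (ω (Fin.natAdd (r₁' + 1 + r₂' + 1) (Fin.last s'), y)).1)
        (fun k y => (ω (Fin.castAdd (s' + 1) k, y)).1)
        (fun k y => (ω (Fin.castAdd (s' + 1) k, y)).2) := by
  have hM1 : ∀ m : Fin (r₁' + 1), ((m : ℕ) : ZMod (r₁' + 1 + r₂' + 1 + (s' + 1))) =
      Fin.castAdd (s' + 1) (Fin.castAdd (r₂' + 1) m) :=
    fun m => natCast_zmod_eq_of_val_eq _ _ (by simp)
  have hM2 : (-1 : ZMod (r₁' + 1 + r₂' + 1 + (s' + 1))) +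
      (((r₁' + 1 : ℕ) : ℕ) : ZMod (r₁' + 1 + r₂' + 1 + (s' + 1))) =
      Fin.castAdd (s' + 1) (Fin.castAdd (r₂' + 1) (Fin.last r₁')) := by
    rw [show (-1 : ZMod (r₁' + 1 + r₂' + 1 + (s' + 1))) +
        (((r₁' + 1 : ℕ) : ℕ) : ZMod (r₁' + 1 + r₂' + 1 + (s' + 1))) =
        ((r₁' : ℕ) : ZMod (r₁' + 1 + r₂' + 1 + (s' + 1))) by push_cast; ring]
    exact natCast_zmod_eq_of_val_eq _ _ (by simp)
  have hM3 : ∀ m : Fin (r₂' + 1), ((m : ℕ) : ZMod (r₁' + 1 + r₂' + 1 + (s' + 1))) +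
      (((r₁' + 1 : ℕ) : ℕ) : ZMod (r₁' + 1 + r₂' + 1 + (s' + 1))) =
      Fin.castAdd (s' + 1) (Fin.natAdd (r₁' + 1) m) := by
    intro m
    rw [← Nat.cast_add]
    exact natCast_zmod_eq_of_val_eq _ _ (by simp; omega)
  unfold torusPairObs torusObs tensorObs
  simp only [Prod.mk_add_mk, add_zero, hM2, hM3]
  simp only [hM1, neg_one_zmod_eq_natAdd_last]

/-- Reading `X · τ_{(r₁'+1+(k'+1), 0)} Y` (gap of `k'+1` free columns) on the glued torus: it is
the concatenation `X ⊠ 1_{k'+1} ⊠ Y`. [folklore] -/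
theorem torusPairObs_eq_tensorObs_freeObs {r₁' r₂' : ℕ} (k' s' : ℕ)
    (X : (G₂ → Bool) → (Fin (r₁' + 1) → G₂ → Bool) → (Fin (r₁' + 1) → G₂ → Bool) → ℝ)
    (Y : (G₂ → Bool) → (Fin (r₂' + 1) → G₂ → Bool) → (Fin (r₂' + 1) → G₂ → Bool) → ℝ)
    (ω : Config (ZMod (r₁' + 1 + k' + 1 + r₂' + 1 + (s' + 1)) × G₂)) :
    torusPairObs r₁' X (r₁' + 1 + (k' + 1)) r₂' Y ω =
      tensorObs (tensorObs X (freeObs (G₂ → Bool) (G₂ → Bool) ℝ k')) Y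
        (fun y => (ω (Fin.natAdd (r₁' + 1 + k' + 1 + r₂' + 1) (Fin.last s'), y)).1)
        (fun k y => (ω (Fin.castAdd (s' + 1) k, y)).1)
        (fun k y => (ω (Fin.castAdd (s' + 1) k, y)).2) := by
  have hM1 : ∀ m : Fin (r₁' + 1), ((m : ℕ) : ZMod (r₁' + 1 + k' + 1 + r₂' + 1 + (s' + 1))) =
      Fin.castAdd (s' + 1) (Fin.castAdd (r₂' + 1) (Fin.castAdd (k' + 1) m)) :=
    fun m => natCast_zmod_eq_of_val_eq _ _ (by simp)
  have hM2 : (-1 : ZMod (r₁' + 1 + k' + 1 + r₂' + 1 + (s' + 1))) +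
      (((r₁' + 1 + (k' + 1) : ℕ) : ℕ) : ZMod (r₁' + 1 + k' + 1 + r₂' + 1 + (s' + 1))) =
      Fin.castAdd (s' + 1) (Fin.castAdd (r₂' + 1) (Fin.last (r₁' + 1 + k'))) := by
    rw [show (-1 : ZMod (r₁' + 1 + k' + 1 + r₂' + 1 + (s' + 1))) +
        (((r₁' + 1 + (k' + 1) : ℕ) : ℕ) : ZMod (r₁' + 1 + k' + 1 + r₂' + 1 + (s' + 1))) =
        ((r₁' + 1 + k' : ℕ) : ZMod (r₁' + 1 + k' + 1 + r₂' + 1 + (s' + 1))) by push_cast; ring]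
    exact natCast_zmod_eq_of_val_eq _ _ (by simp)
  have hM3 : ∀ m : Fin (r₂' + 1), ((m : ℕ) : ZMod (r₁' + 1 + k' + 1 + r₂' + 1 + (s' + 1))) +
      (((r₁' + 1 + (k' + 1) : ℕ) : ℕ) : ZMod (r₁' + 1 + k' + 1 + r₂' + 1 + (s' + 1))) =
      Fin.castAdd (s' + 1) (Fin.natAdd (r₁' + 1 + k' + 1) m) := by
    intro m
    rw [← Nat.cast_add]
    exact natCast_zmod_eq_of_val_eq _ _ (by simp; omega)
  unfold torusPairObs torusObs tensorObs freeObs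
  simp only [Prod.mk_add_mk, add_zero, hM2, hM3, mul_one]
  simp only [hM1, neg_one_zmod_eq_natAdd_last]

end Reading

/-! ## 3. Strip observables on `ℓ²(𝔅)` and Corollary 56 (3) -/

section TorusObs

variable {G₂ : Type*} [AddGroup G₂] [One G₂] [Fintype G₂] [DecidableEq G₂]

/-- The balanced six-vertex column weights as a column weight on `𝔆`.
[cite: DKLM2026SixVertexGFF, Cor. 56 (1)] -/
def balColWeight (a b c : ℝ) (i j : {κ : G₂ → Bool // IsBalancedCol κ}) (β : G₂ → Bool) : ℝ :=
  columnWeight a b c i.1 j.1 β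

/-- `colMatrix (balColWeight a b c) = t_𝔆`. [cite: DKLM2026SixVertexGFF, Cor. 56 (1)] -/
theorem colMatrix_balColWeight (a b c : ℝ) :
    colMatrix (balColWeight (G₂ := G₂) a b c) = balancedTransferMatrix a b c := by
  ext i j
  rfl

/-- A **strip observable in column-state form** on `r' + 1` columns of `ℤ × G₂`: a function of
the incoming horizontal arrows, the `r' + 1` columns of horizontal arrows and the `r' + 1`
columns of vertical arrows, restricted to balanced column states (the vectors of `Ω = ℓ²(𝔅)`).
[cite: DKLM2026SixVertexGFF, Part III §1] -/
def balObs {r' : ℕ}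
    (X : (G₂ → Bool) → (Fin (r' + 1) → G₂ → Bool) → (Fin (r' + 1) → G₂ → Bool) → ℝ) :
    {κ : G₂ → Bool // IsBalancedCol κ} → (Fin (r' + 1) → {κ : G₂ → Bool // IsBalancedCol κ}) →
      (Fin (r' + 1) → G₂ → Bool) → ℝ :=
  fun i κ α => X i.1 (fun k => (κ k).1) α

/-- **The operator `𝔬_X : Ω → Ω`** of a strip observable of the six-vertex model on `ℓ²(𝔅)`.
[cite: DKLM2026SixVertexGFF, Part III §1, eq. (operator def) and Cor. 56] -/
def balObsMatrix (a b c : ℝ) (r' : ℕ)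
    (X : (G₂ → Bool) → (Fin (r' + 1) → G₂ → Bool) → (Fin (r' + 1) → G₂ → Bool) → ℝ) :
    Matrix {κ : G₂ → Bool // IsBalancedCol κ} {κ : G₂ → Bool // IsBalancedCol κ} ℝ :=
  obsMatrix r' (balColWeight a b c) (balObs X)

omit [AddGroup G₂] [One G₂] [DecidableEq G₂] in
/-- Restriction to `𝔅` commutes with concatenation. [folklore] -/
theorem balObs_tensorObs {r₁' r₂' : ℕ}
    (X : (G₂ → Bool) → (Fin (r₁' + 1) → G₂ → Bool) → (Fin (r₁' + 1) → G₂ → Bool) → ℝ)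
    (Y : (G₂ → Bool) → (Fin (r₂' + 1) → G₂ → Bool) → (Fin (r₂' + 1) → G₂ → Bool) → ℝ) :
    balObs (tensorObs X Y) = tensorObs (balObs X) (balObs Y) :=
  rfl

omit [AddGroup G₂] [One G₂] [DecidableEq G₂] in
/-- Restriction to `𝔅` of the free observable. [folklore] -/
theorem balObs_freeObs (k' : ℕ) :
    balObs (freeObs (G₂ → Bool) (G₂ → Bool) ℝ k') =
      freeObs {κ : G₂ → Bool // IsBalancedCol κ} (G₂ → Bool) ℝ k' :=
  rfl

omit [AddGroup G₂] [One G₂] [DecidableEq G₂] in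
/-- `Fin.cons` commutes with taking the underlying column state. [folklore] -/
theorem val_cons_apply {n : ℕ} (i : {κ : G₂ → Bool // IsBalancedCol κ})
    (κ : Fin n → {κ : G₂ → Bool // IsBalancedCol κ}) (y : Fin (n + 1)) :
    ((Fin.cons i κ : Fin (n + 1) → {κ : G₂ → Bool // IsBalancedCol κ}) y).1 =
      (Fin.cons i.1 (fun k => (κ k).1) : Fin (n + 1) → G₂ → Bool) y := by
  induction y using Fin.cases with
  | zero => rw [Fin.cons_zero, Fin.cons_zero]
  | succ m => rw [Fin.cons_succ, Fin.cons_succ]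

omit [AddGroup G₂] [One G₂] [DecidableEq G₂] in
/-- Restriction to `𝔅` commutes with the reflection `†`. [folklore] -/
theorem balObs_reflectObs {r' : ℕ}
    (X : (G₂ → Bool) → (Fin (r' + 1) → G₂ → Bool) → (Fin (r' + 1) → G₂ → Bool) → ℝ) :
    balObs (reflectObs X) = reflectObs (balObs X) := by
  funext i κ α
  simp only [balObs, reflectObs, val_cons_apply]

/-- **Corollary 56 (4) on `Ω = ℓ²(𝔅)`**: at `a = b` the operator of the reflected observable is
the transpose, `𝔬_{X†} = (𝔬_X)ᵀ` (real symmetric setting: `† = ᵀ`).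
[cite: DKLM2026SixVertexGFF, Cor. 56 (4)] -/
theorem balObsMatrix_reflectObs (a c : ℝ) (r' : ℕ)
    (X : (G₂ → Bool) → (Fin (r' + 1) → G₂ → Bool) → (Fin (r' + 1) → G₂ → Bool) → ℝ) :
    balObsMatrix a a c r' (reflectObs X) = (balObsMatrix a a c r' X)ᵀ := by
  unfold balObsMatrix
  rw [balObs_reflectObs]
  exact obsMatrix_reflectObs _ (fun i j β => columnWeight_swap a a c i.1 j.1 β) _

open scoped Classical in
/-- **Corollary 56 (3) for strip observables** (`Z ℙ[bal] 𝔼[X | bal] = Trace 𝔬_X^{0M}`): on the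
torus `ZMod (r'+1+(s'+1)) × G₂`, for a real observable `F` reading the incoming column `r'+1+s'`
and the columns `0, …, r'` through the column-state observable `X`,
`∑_{ω balanced} F(ω) W(ω) = Trace (𝔬_X · t_𝔅^{s'+1})`. [cite: DKLM2026SixVertexGFF, Cor. 56 (3)] -/
theorem sum_ite_isBalanced_obs_eq_trace (a b c : ℝ) (r' s' : ℕ)
    (X : (G₂ → Bool) → (Fin (r' + 1) → G₂ → Bool) → (Fin (r' + 1) → G₂ → Bool) → ℝ)
    (F : Config (ZMod (r' + 1 + (s' + 1)) × G₂) → ℝ)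
    (hF : ∀ ω, F ω = X (fun y => (ω (Fin.natAdd (r' + 1) (Fin.last s'), y)).1)
      (fun k y => (ω (Fin.castAdd (s' + 1) k, y)).1) (fun k y => (ω (Fin.castAdd (s' + 1) k, y)).2)) :
    (∑ ω : Config (ZMod (r' + 1 + (s' + 1)) × G₂),
        if IsBalanced ω then F ω * torusWeight a b c ω else 0) =
      Matrix.trace (balObsMatrix a b c r' X * balancedTransferMatrix a b c ^ (s' + 1)) := by
  -- Step 1: split configurations into columns of horizontal and vertical arrows
  rw [← (columnSplit (ZMod (r' + 1 + (s' + 1))) G₂).symm.sum_comp, Fintype.sum_prod_type]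
  have h1 : ∀ κ : ZMod (r' + 1 + (s' + 1)) → G₂ → Bool,
      (∑ α : ZMod (r' + 1 + (s' + 1)) → G₂ → Bool,
        if IsBalanced ((columnSplit (ZMod (r' + 1 + (s' + 1))) G₂).symm (κ, α)) then
          F ((columnSplit (ZMod (r' + 1 + (s' + 1))) G₂).symm (κ, α)) *
            torusWeight a b c ((columnSplit (ZMod (r' + 1 + (s' + 1))) G₂).symm (κ, α)) else 0) =
      if ∀ x, IsBalancedCol (κ x) then
        ∑ α : ZMod (r' + 1 + (s' + 1)) → G₂ → Bool,
          X (κ (Fin.natAdd (r' + 1) (Fin.last s'))) (fun k => κ (Fin.castAdd (s' + 1) k))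
              (fun k => α (Fin.castAdd (s' + 1) k)) *
            ∏ x, columnWeight a b c (κ (x - 1)) (κ x) (α x)
      else 0 := by
    intro κ
    have hbal : ∀ α : ZMod (r' + 1 + (s' + 1)) → G₂ → Bool,
        IsBalanced ((columnSplit (ZMod (r' + 1 + (s' + 1))) G₂).symm (κ, α)) ↔
          ∀ x, IsBalancedCol (κ x) := fun α => Iff.rfl
    have hFX : ∀ α : ZMod (r' + 1 + (s' + 1)) → G₂ → Bool,
        F ((columnSplit (ZMod (r' + 1 + (s' + 1))) G₂).symm (κ, α)) =
          X (κ (Fin.natAdd (r' + 1) (Fin.last s'))) (fun k => κ (Fin.castAdd (s' + 1) k))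
            (fun k => α (Fin.castAdd (s' + 1) k)) := fun α => hF _
    have hW : ∀ α : ZMod (r' + 1 + (s' + 1)) → G₂ → Bool,
        torusWeight a b c ((columnSplit (ZMod (r' + 1 + (s' + 1))) G₂).symm (κ, α)) =
          ∏ x, columnWeight a b c (κ (x - 1)) (κ x) (α x) :=
      fun α => torusWeight_eq_prod_columnWeight a b c _
    by_cases hb : ∀ x, IsBalancedCol (κ x)
    · rw [if_pos hb]
      refine Finset.sum_congr rfl fun α _ => ?_
      rw [if_pos ((hbal α).2 hb), hFX, hW]
    · rw [if_neg hb]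
      refine Finset.sum_eq_zero fun α _ => ?_
      rw [if_neg (fun h => hb ((hbal α).1 h))]
  simp only [h1]
  -- Step 2: restrict to everywhere-balanced `κ`, i.e. to `κ : ZMod _ → 𝔆`
  rw [← Finset.sum_filter,
    Finset.sum_subtype
      (Finset.univ.filter fun κ : ZMod (r' + 1 + (s' + 1)) → G₂ → Bool => ∀ x, IsBalancedCol (κ x))
      (p := fun κ : ZMod (r' + 1 + (s' + 1)) → G₂ → Bool => ∀ x, IsBalancedCol (κ x)) (by simp),
    ← (Equiv.subtypePiEquivPi (β := fun _ : ZMod (r' + 1 + (s' + 1)) => G₂ → Bool)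
      (p := fun _ κ => IsBalancedCol κ)).symm.sum_comp]
  -- Step 3: the strip factorisation for observables
  unfold balObsMatrix
  rw [← colMatrix_balColWeight a b c, ← sum_obs_cyclic_eq_trace r' s']
  refine Finset.sum_congr rfl fun p _ => Finset.sum_congr rfl fun α _ => ?_
  rfl

/-- **The conditional expectation of a strip observable as a ratio of traces** (Cor. 56 (3)
divided by the partition function, eq. (cylop) before the limit):
`𝔼_{𝕋_{M,L}}[X | balanced] = Trace(𝔬_X t_𝔅^{s'+1}) / Trace(t_𝔅^{(s'+1)+(r'+1)})`,
`M = r' + 1 + (s' + 1)`. [cite: DKLM2026SixVertexGFF, Part III §1, eq. (cylop)] -/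
theorem torusCondExp_eq_trace_div_trace (a b c : ℝ) (r' s' : ℕ)
    (X : (G₂ → Bool) → (Fin (r' + 1) → G₂ → Bool) → (Fin (r' + 1) → G₂ → Bool) → ℝ)
    (F : Config (ZMod (r' + 1 + (s' + 1)) × G₂) → ℝ)
    (hF : ∀ ω, F ω = X (fun y => (ω (Fin.natAdd (r' + 1) (Fin.last s'), y)).1)
      (fun k y => (ω (Fin.castAdd (s' + 1) k, y)).1) (fun k y => (ω (Fin.castAdd (s' + 1) k, y)).2)) :
    torusCondExp a b c F =
      Matrix.trace (balObsMatrix a b c r' X * balancedTransferMatrix a b c ^ (s' + 1)) /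
        Matrix.trace (balancedTransferMatrix (G₂ := G₂) a b c ^ (s' + 1 + (r' + 1))) := by
  classical
  unfold torusCondExp
  rw [sum_ite_isBalanced_obs_eq_trace a b c r' s' X F hF]
  congr 1
  have hden := sum_torusWeight_filter_isBalanced_eq_trace (G₂ := G₂) a b c (r' + 1 + s')
  rw [Finset.sum_filter] at hden
  rw [show s' + 1 + (r' + 1) = r' + 1 + s' + 1 by omega]
  exact hden

/-- **`𝔼_{𝕋_{M, G₂}}[X | balanced]`** for a strip observable, as a function of the number of
columns `M` (`0` for `M = 0`), at `a = b = 1`. [cite: DKLM2026SixVertexGFF, Lemma 22 / eq. (cylop)] -/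
def torusObsExp (c : ℝ) (M : ℕ) (r' : ℕ)
    (X : (G₂ → Bool) → (Fin (r' + 1) → G₂ → Bool) → (Fin (r' + 1) → G₂ → Bool) → ℝ) : ℝ :=
  if hM : M = 0 then 0 else
    haveI : NeZero M := ⟨hM⟩
    torusCondExp 1 1 c (torusObs (M := M) r' X)

/-- **eq. (cylop) before the limit**:
`𝔼_{𝕋_{M,L}}[X | balanced] = Trace(𝔬_X t_𝔅^{s+1}) / Trace(t_𝔅^{(s+1)+(r'+1)})`, `M = r'+1+(s+1)`.
[cite: DKLM2026SixVertexGFF, Part III §1, eq. (cylop)] -/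
theorem torusObsExp_eq_trace_div_trace (c : ℝ) (r' s : ℕ)
    (X : (G₂ → Bool) → (Fin (r' + 1) → G₂ → Bool) → (Fin (r' + 1) → G₂ → Bool) → ℝ) :
    torusObsExp c (r' + 1 + (s + 1)) r' X =
      Matrix.trace (balObsMatrix 1 1 c r' X * balancedTransferMatrix 1 1 c ^ (s + 1)) /
        Matrix.trace (balancedTransferMatrix (G₂ := G₂) 1 1 c ^ (s + 1 + (r' + 1))) := by
  unfold torusObsExp
  rw [dif_neg (by omega)]
  exact torusCondExp_eq_trace_div_trace 1 1 c r' s X _ (torusObs_eq r' s X)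

/-- Positive lower bound on the diagonal of `t_𝔆` (`a = b = 1`, `c > 0`). [folklore] -/
theorem exists_balancedTransferMatrix_diag_ge (c : ℝ) (hc : 0 < c)
    [Nonempty {κ : G₂ → Bool // IsBalancedCol κ}] :
    ∃ δ : ℝ, 0 < δ ∧ ∀ i, δ ≤ balancedTransferMatrix (G₂ := G₂) 1 1 c i i := by
  set t := balancedTransferMatrix (G₂ := G₂) 1 1 c with ht
  refine ⟨Finset.univ.inf' Finset.univ_nonempty (fun i => t i i), ?_, fun i =>
    Finset.inf'_le _ (Finset.mem_univ i)⟩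
  obtain ⟨i₀, -, h⟩ := Finset.exists_mem_eq_inf' Finset.univ_nonempty (fun i => t i i)
  rw [h]
  exact balancedTransferMatrix_diag_pos zero_lt_one zero_lt_one hc.le i₀

/-- Off-diagonal (indeed all) entries of `t_𝔆` are nonnegative. [folklore] -/
theorem balancedTransferMatrix_offdiag_nonneg (c : ℝ) (hc : 0 < c) :
    ∀ i j : {κ : G₂ → Bool // IsBalancedCol κ}, i ≠ j →
      0 ≤ balancedTransferMatrix (G₂ := G₂) 1 1 c i j :=
  fun i j _ => balancedTransferMatrix_nonneg zero_le_one zero_le_one hc.le i j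

/-- **Lemma 22 for strip observables**: `𝔼_{𝕋_{M,L}}[X | balanced]` converges as `M → ∞`, for
every `c > 0` and every strip observable. [cite: DKLM2026SixVertexGFF, Lemma 22 and eq. (cylop)] -/
theorem exists_tendsto_torusObsExp (c : ℝ) (hc : 0 < c) (r' : ℕ)
    (X : (G₂ → Bool) → (Fin (r' + 1) → G₂ → Bool) → (Fin (r' + 1) → G₂ → Bool) → ℝ) :
    ∃ q : ℝ, Tendsto (fun M : ℕ => torusObsExp c M r' X) atTop (𝓝 q) := by
  rcases isEmpty_or_nonempty {κ : G₂ → Bool // IsBalancedCol κ} with hE | hne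
  · refine ⟨0, (tendsto_add_atTop_iff_nat (r' + 2)).1 (tendsto_const_nhds.congr fun s => ?_)⟩
    rw [show s + (r' + 2) = r' + 1 + (s + 1) by omega, torusObsExp_eq_trace_div_trace]
    simp [Matrix.trace]
  · obtain ⟨δ, hδ, hdiag⟩ := exists_balancedTransferMatrix_diag_ge (G₂ := G₂) c hc
    have hlim := (tendsto_trace_mul_pow_div_trace_pow_add (balancedTransferMatrix_isHermitian 1 c)
      (balancedTransferMatrix_offdiag_nonneg c hc) hδ hdiag (balObsMatrix 1 1 c r' X)
      (r' + 1)).comp (tendsto_add_atTop_nat 1)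
    refine ⟨_, (tendsto_add_atTop_iff_nat (r' + 2)).1 (hlim.congr fun s => ?_)⟩
    rw [Function.comp_apply, show s + (r' + 2) = r' + 1 + (s + 1) by omega,
      torusObsExp_eq_trace_div_trace c r' s X]

/-- **`𝔼_{CYL_L}[X]`**, the cylinder expectation of a strip observable:
`lim_{M → ∞} 𝔼_{𝕋_{M,L}}[X | balanced]` (Lemma 22; Mathlib's `limUnder`, meaningful for `c > 0`).
[cite: DKLM2026SixVertexGFF, Lemma 22 and eq. (cylop)] -/
def cylinderObsExp (c : ℝ) (r' : ℕ)
    (X : (G₂ → Bool) → (Fin (r' + 1) → G₂ → Bool) → (Fin (r' + 1) → G₂ → Bool) → ℝ) : ℝ :=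
  limUnder atTop fun M : ℕ => torusObsExp c M r' X

/-- `𝔼_{𝕋_{M,L}}[X | balanced] → 𝔼_{CYL_L}[X]`. [cite: DKLM2026SixVertexGFF, Lemma 22] -/
theorem tendsto_cylinderObsExp (c : ℝ) (hc : 0 < c) (r' : ℕ)
    (X : (G₂ → Bool) → (Fin (r' + 1) → G₂ → Bool) → (Fin (r' + 1) → G₂ → Bool) → ℝ) :
    Tendsto (fun M : ℕ => torusObsExp c M r' X) atTop (𝓝 (cylinderObsExp c r' X)) := by
  obtain ⟨q, hq⟩ := exists_tendsto_torusObsExp c hc r' X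
  exact tendsto_nhds_limUnder ⟨q, hq⟩

/-- **eq. (cylop)**: `𝔼_{CYL_L}[X] = (∑_{i : λ_i = Λ} (Uᵀ 𝔬_X U)_{ii}) / (d Λ^{r'+1})` — the
normalised top-eigenspace average of `𝔬_X` (`= v_0† 𝔒_X v_0` when the top eigenvalue `Λ` of
`t_𝔅` is simple, `d = 1`). [cite: DKLM2026SixVertexGFF, Part III §1, eq. (cylop)] -/
theorem cylinderObsExp_eq (c : ℝ) (hc : 0 < c) (r' : ℕ) [Nonempty {κ : G₂ → Bool // IsBalancedCol κ}]
    (X : (G₂ → Bool) → (Fin (r' + 1) → G₂ → Bool) → (Fin (r' + 1) → G₂ → Bool) → ℝ) :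
    cylinderObsExp c r' X =
      (∑ i ∈ univ.filter (fun i => (balancedTransferMatrix_isHermitian (G₂ := G₂) 1 c).eigenvalues i =
          topEigenvalue (balancedTransferMatrix_isHermitian (G₂ := G₂) 1 c)),
        (star (eigU (balancedTransferMatrix_isHermitian (G₂ := G₂) 1 c)) * balObsMatrix 1 1 c r' X *
          eigU (balancedTransferMatrix_isHermitian (G₂ := G₂) 1 c)) i i) /
      ((univ.filter fun i => (balancedTransferMatrix_isHermitian (G₂ := G₂) 1 c).eigenvalues i =
          topEigenvalue (balancedTransferMatrix_isHermitian (G₂ := G₂) 1 c)).card *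
        topEigenvalue (balancedTransferMatrix_isHermitian (G₂ := G₂) 1 c) ^ (r' + 1)) := by
  obtain ⟨δ, hδ, hdiag⟩ := exists_balancedTransferMatrix_diag_ge (G₂ := G₂) c hc
  have hlim := (tendsto_trace_mul_pow_div_trace_pow_add (balancedTransferMatrix_isHermitian 1 c)
    (balancedTransferMatrix_offdiag_nonneg c hc) hδ hdiag (balObsMatrix 1 1 c r' X)
    (r' + 1)).comp (tendsto_add_atTop_nat 1)
  have h2 : Tendsto (fun M : ℕ => torusObsExp c M r' X) atTop (𝓝 _) :=
    (tendsto_add_atTop_iff_nat (r' + 2)).1 (hlim.congr fun s => by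
      rw [Function.comp_apply, show s + (r' + 2) = r' + 1 + (s + 1) by omega,
        torusObsExp_eq_trace_div_trace c r' s X])
  exact tendsto_nhds_unique (tendsto_cylinderObsExp c hc r' X) h2

/-! ## 4. The spectral representation of pair correlations (Theorem 26) -/

/-- **The atoms `a_j = 1 - λ_j/Λ`** of the spectral measures `μ_{X,Y,L}` (`λ_j` the eigenvalues of
`t_𝔅 = t(π/2)`, `Λ` the largest; `Λ_j = λ_j/Λ` in the source). [cite: DKLM2026SixVertexGFF, Part III §2, Step 1] -/
def spectralAtom (c : ℝ) [Nonempty {κ : G₂ → Bool // IsBalancedCol κ}]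
    (j : {κ : G₂ → Bool // IsBalancedCol κ}) : ℝ :=
  1 - (balancedTransferMatrix_isHermitian (G₂ := G₂) 1 c).eigenvalues j /
    topEigenvalue (balancedTransferMatrix_isHermitian (G₂ := G₂) 1 c)

/-- **The spectral measure is supported on `[0, 2)`**: `a_j ∈ [0, 2)` (`-Λ` is not an eigenvalue;
Remark 58 / Theorem 26). [cite: DKLM2026SixVertexGFF, Theorem 26 and Remark 58] -/
theorem spectralAtom_mem_Ico (c : ℝ) (hc : 0 < c) [Nonempty {κ : G₂ → Bool // IsBalancedCol κ}]
    (j : {κ : G₂ → Bool // IsBalancedCol κ}) : spectralAtom c j ∈ Set.Ico (0 : ℝ) 2 := by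
  obtain ⟨δ, hδ, hdiag⟩ := exists_balancedTransferMatrix_diag_ge (G₂ := G₂) c hc
  exact one_sub_eigenvalues_div_topEigenvalue_mem_Ico _
    (balancedTransferMatrix_offdiag_nonneg c hc) hδ hdiag j

/-- **The weights of the spectral measure `μ_{X,Y,L} = ∑_j c_j(X,Y) δ_{a_j}`** of a pair of strip
observables (`X` on `r₁'+1` columns to the left of `Y` on `r₂'+1` columns):
`c_j(X,Y) = (∑_{i : λ_i = Λ} (Uᵀ𝔬_XU)_{ij} (Uᵀ𝔬_YU)_{ji}) / (d Λ^{(r₁'+1)+(r₂'+1)})`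
(Step 1 of the proof of Thm 26, with the top-eigenspace average in place of `v_0 v_0†`).
[cite: DKLM2026SixVertexGFF, Theorem 26 and Part III §2, Step 1] -/
def spectralWeight (c : ℝ) [Nonempty {κ : G₂ → Bool // IsBalancedCol κ}] {r₁' r₂' : ℕ}
    (X : (G₂ → Bool) → (Fin (r₁' + 1) → G₂ → Bool) → (Fin (r₁' + 1) → G₂ → Bool) → ℝ)
    (Y : (G₂ → Bool) → (Fin (r₂' + 1) → G₂ → Bool) → (Fin (r₂' + 1) → G₂ → Bool) → ℝ)
    (j : {κ : G₂ → Bool // IsBalancedCol κ}) : ℝ :=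
  pairSpectralWeight (balancedTransferMatrix_isHermitian (G₂ := G₂) 1 c)
      (balObsMatrix 1 1 c r₁' X) (balObsMatrix 1 1 c r₂' Y) j /
    (((univ.filter fun i => (balancedTransferMatrix_isHermitian (G₂ := G₂) 1 c).eigenvalues i =
          topEigenvalue (balancedTransferMatrix_isHermitian (G₂ := G₂) 1 c)).card : ℝ) *
      topEigenvalue (balancedTransferMatrix_isHermitian (G₂ := G₂) 1 c) ^ (r₁' + 1 + (r₂' + 1)))

/-- **Theorem 26 (i) at the operator level**: for `c > 0` and strip observables `X`, `Y`,
`Trace(𝔬_X t^k 𝔬_Y t^s) / Trace(t^{s + (r₁'+1) + (r₂'+1) + k}) → ∑_j c_j(X,Y) (1 - a_j)^k` as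
`s → ∞` — i.e. `𝔼_{CYL_L}[X · τ_{(k,0)} Y] = ∫ (1-a)^k dμ_{X,Y,L}(a)` once the left-hand side is
identified with the cylinder expectation (`tendsto_torusPairExp`).
[cite: DKLM2026SixVertexGFF, Theorem 26 (i) and Part III §2, Step 2] -/
theorem tendsto_trace_obs_pow_obs_pow_div (c : ℝ) (hc : 0 < c)
    [Nonempty {κ : G₂ → Bool // IsBalancedCol κ}] {r₁' r₂' : ℕ}
    (X : (G₂ → Bool) → (Fin (r₁' + 1) → G₂ → Bool) → (Fin (r₁' + 1) → G₂ → Bool) → ℝ)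
    (Y : (G₂ → Bool) → (Fin (r₂' + 1) → G₂ → Bool) → (Fin (r₂' + 1) → G₂ → Bool) → ℝ) (k : ℕ) :
    Tendsto (fun s : ℕ =>
        Matrix.trace (balObsMatrix 1 1 c r₁' X * balancedTransferMatrix 1 1 c ^ k *
            balObsMatrix 1 1 c r₂' Y * balancedTransferMatrix 1 1 c ^ s) /
          Matrix.trace (balancedTransferMatrix (G₂ := G₂) 1 1 c ^ (s + (r₁' + 1 + (r₂' + 1) + k))))
      atTop (𝓝 (∑ j, spectralWeight c X Y j * (1 - spectralAtom c j) ^ k)) := by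
  obtain ⟨δ, hδ, hdiag⟩ := exists_balancedTransferMatrix_diag_ge (G₂ := G₂) c hc
  have h := tendsto_trace_mul_pow_mul_mul_pow_div' (balancedTransferMatrix_isHermitian 1 c)
    (balancedTransferMatrix_offdiag_nonneg c hc) hδ hdiag (balObsMatrix 1 1 c r₁' X)
    (balObsMatrix 1 1 c r₂' Y) k (r₁' + 1 + (r₂' + 1))
  convert h using 2
  simp only [spectralWeight, spectralAtom, sub_sub_cancel, Finset.sum_div]
  refine Finset.sum_congr rfl fun j _ => ?_
  ring

/-! ### Identification with the cylinder measure: `𝔼_{CYL_L}[X · τ_{(n,0)} Y]` -/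

/-- **`𝔼_{𝕋_{M,L}}[X · τ_{(n,0)} Y | balanced]`** as a function of `M` (`0` for `M = 0`), at
`a = b = 1`. [cite: DKLM2026SixVertexGFF, Theorem 26 (i)] -/
def torusPairExp (c : ℝ) (M : ℕ) (r₁' : ℕ)
    (X : (G₂ → Bool) → (Fin (r₁' + 1) → G₂ → Bool) → (Fin (r₁' + 1) → G₂ → Bool) → ℝ) (n : ℕ)
    (r₂' : ℕ) (Y : (G₂ → Bool) → (Fin (r₂' + 1) → G₂ → Bool) → (Fin (r₂' + 1) → G₂ → Bool) → ℝ) :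
    ℝ :=
  if hM : M = 0 then 0 else
    haveI : NeZero M := ⟨hM⟩
    torusCondExp 1 1 c (torusPairObs (M := M) r₁' X n r₂' Y)

/-- **`𝔼_{𝕋_{M,L}}[X · τ_k Y | balanced]` as a ratio of traces** (Cor. 56 (2)–(3), (5): Step 2
of the proof of Theorem 26 on the torus): with `M = (r₁'+1) + k + (r₂'+1) + (s+1)` columns,
`𝔼_{𝕋_{M,L}}[X · τ_{(r₁'+1+k, 0)} Y | balanced] = Trace(𝔬_X t^k 𝔬_Y t^{s+1}) / Trace(t^M)`.
[cite: DKLM2026SixVertexGFF, Part III §2, Step 2] -/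
theorem torusPairExp_eq_trace_div_trace (c : ℝ) {r₁' r₂' : ℕ}
    (X : (G₂ → Bool) → (Fin (r₁' + 1) → G₂ → Bool) → (Fin (r₁' + 1) → G₂ → Bool) → ℝ)
    (Y : (G₂ → Bool) → (Fin (r₂' + 1) → G₂ → Bool) → (Fin (r₂' + 1) → G₂ → Bool) → ℝ) (k s : ℕ) :
    torusPairExp c (r₁' + k + r₂' + s + 3) r₁' X (r₁' + 1 + k) r₂' Y =
      Matrix.trace (balObsMatrix 1 1 c r₁' X * balancedTransferMatrix 1 1 c ^ k *
          balObsMatrix 1 1 c r₂' Y * balancedTransferMatrix 1 1 c ^ (s + 1)) /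
        Matrix.trace (balancedTransferMatrix (G₂ := G₂) 1 1 c ^ (s + 1 + (r₁' + 1 + (r₂' + 1) + k))) := by
  cases k with
  | zero =>
    rw [show r₁' + 0 + r₂' + s + 3 = r₁' + 1 + r₂' + 1 + (s + 1) by omega]
    unfold torusPairExp
    rw [dif_neg (by omega)]
    rw [torusCondExp_eq_trace_div_trace 1 1 c (r₁' + 1 + r₂') s (tensorObs X Y)
        (torusPairObs r₁' X (r₁' + 1 + 0) r₂' Y) (fun ω => torusPairObs_eq_tensorObs s X Y ω)]
    unfold balObsMatrix
    rw [balObs_tensorObs, obsMatrix_tensorObs, pow_zero, Matrix.mul_one,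
      show s + 1 + (r₁' + 1 + r₂' + 1) = s + 1 + (r₁' + 1 + (r₂' + 1) + 0) by omega]
  | succ k' =>
    rw [show r₁' + (k' + 1) + r₂' + s + 3 = r₁' + 1 + k' + 1 + r₂' + 1 + (s + 1) by omega]
    unfold torusPairExp
    rw [dif_neg (by omega)]
    rw [torusCondExp_eq_trace_div_trace 1 1 c (r₁' + 1 + k' + 1 + r₂') s
        (tensorObs (tensorObs X (freeObs (G₂ → Bool) (G₂ → Bool) ℝ k')) Y) _
        (torusPairObs_eq_tensorObs_freeObs k' s X Y)]
    unfold balObsMatrix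
    rw [balObs_tensorObs, balObs_tensorObs, balObs_freeObs, obsMatrix_tensorObs_freeObs_tensorObs,
      colMatrix_balColWeight,
      show s + 1 + (r₁' + 1 + k' + 1 + r₂' + 1) = s + 1 + (r₁' + 1 + (r₂' + 1) + (k' + 1)) by omega]

/-- **Theorem 26 (i) (spectral representation of general observables).** Fix `c > 0` and an even
circumference with `𝔅 ≠ ∅`. For strip observables `X` (on the columns `0..r₁'`) and `Y` (on
`r₂'+1` columns) and every `k ≥ 0`, the balanced torus expectations
`𝔼_{𝕋_{M,L}}[X · τ_{(r₁'+1+k, 0)} Y | balanced]` converge as `M → ∞` — to the cylinder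
expectation `𝔼_{CYL_L}[X · τ_k Y]` of Lemma 22 — and the limit is
`∫ (1 - a)^k dμ_{X,Y,L}(a) = ∑_j c_j(X,Y) (1 - a_j)^k` for the finite (signed) measure
`μ_{X,Y,L} = ∑_j c_j(X,Y) δ_{a_j}` supported on `[0, 2)` (`spectralAtom_mem_Ico`), the same for
all `k`. [cite: DKLM2026SixVertexGFF, Theorem 26 (i)] -/
theorem tendsto_torusPairExp (c : ℝ) (hc : 0 < c) [Nonempty {κ : G₂ → Bool // IsBalancedCol κ}]
    {r₁' r₂' : ℕ}
    (X : (G₂ → Bool) → (Fin (r₁' + 1) → G₂ → Bool) → (Fin (r₁' + 1) → G₂ → Bool) → ℝ)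
    (Y : (G₂ → Bool) → (Fin (r₂' + 1) → G₂ → Bool) → (Fin (r₂' + 1) → G₂ → Bool) → ℝ) (k : ℕ) :
    Tendsto (fun M : ℕ => torusPairExp c M r₁' X (r₁' + 1 + k) r₂' Y) atTop
      (𝓝 (∑ j, spectralWeight c X Y j * (1 - spectralAtom c j) ^ k)) := by
  have hlim := (tendsto_trace_obs_pow_obs_pow_div c hc X Y k).comp (tendsto_add_atTop_nat 1)
  refine (tendsto_add_atTop_iff_nat (r₁' + k + r₂' + 3)).1 (hlim.congr fun s => ?_)
  rw [Function.comp_apply, show s + (r₁' + k + r₂' + 3) = r₁' + k + r₂' + s + 3 by omega,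
    torusPairExp_eq_trace_div_trace c X Y k s]

/-- **`𝔼_{CYL_L}[X · τ_{(n,0)} Y]`** `:= lim_{M → ∞} 𝔼_{𝕋_{M,L}}[X · τ_{(n,0)} Y | balanced]`.
[cite: DKLM2026SixVertexGFF, Theorem 26 (i) / Lemma 22] -/
def cylinderPairExp (c : ℝ) (r₁' : ℕ)
    (X : (G₂ → Bool) → (Fin (r₁' + 1) → G₂ → Bool) → (Fin (r₁' + 1) → G₂ → Bool) → ℝ) (n : ℕ)
    (r₂' : ℕ) (Y : (G₂ → Bool) → (Fin (r₂' + 1) → G₂ → Bool) → (Fin (r₂' + 1) → G₂ → Bool) → ℝ) :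
    ℝ :=
  limUnder atTop fun M : ℕ => torusPairExp c M r₁' X n r₂' Y

/-- **Theorem 26 (i) for the cylinder measure**:
`𝔼_{CYL_L}[X · τ_{(r₁'+1+k,0)} Y] = ∑_j c_j(X,Y) (1 - a_j)^k = ∫ (1-a)^k dμ_{X,Y,L}(a)`.
[cite: DKLM2026SixVertexGFF, Theorem 26 (i)] -/
theorem cylinderPairExp_eq_sum (c : ℝ) (hc : 0 < c) [Nonempty {κ : G₂ → Bool // IsBalancedCol κ}]
    {r₁' r₂' : ℕ}
    (X : (G₂ → Bool) → (Fin (r₁' + 1) → G₂ → Bool) → (Fin (r₁' + 1) → G₂ → Bool) → ℝ)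
    (Y : (G₂ → Bool) → (Fin (r₂' + 1) → G₂ → Bool) → (Fin (r₂' + 1) → G₂ → Bool) → ℝ) (k : ℕ) :
    cylinderPairExp c r₁' X (r₁' + 1 + k) r₂' Y =
      ∑ j, spectralWeight c X Y j * (1 - spectralAtom c j) ^ k :=
  (tendsto_torusPairExp c hc X Y k).limUnder_eq

/-! ### Theorem 26 (ii): reflection positivity and the Cauchy–Schwarz inequality -/

/-- The normalising constant `d Λ^r` is positive. [folklore] -/
theorem card_mul_topEigenvalue_pow_pos (c : ℝ) (hc : 0 < c)
    [Nonempty {κ : G₂ → Bool // IsBalancedCol κ}] (r : ℕ) :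
    0 < ((univ.filter fun i => (balancedTransferMatrix_isHermitian (G₂ := G₂) 1 c).eigenvalues i =
          topEigenvalue (balancedTransferMatrix_isHermitian (G₂ := G₂) 1 c)).card : ℝ) *
      topEigenvalue (balancedTransferMatrix_isHermitian (G₂ := G₂) 1 c) ^ r := by
  obtain ⟨δ, hδ, hdiag⟩ := exists_balancedTransferMatrix_diag_ge (G₂ := G₂) c hc
  have hL := topEigenvalue_pos_of_diag (balancedTransferMatrix_isHermitian (G₂ := G₂) 1 c) hδ hdiag
  refine mul_pos ?_ (pow_pos hL r)
  obtain ⟨i₀, hi₀⟩ := exists_eigenvalues_eq_topEigenvalue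
    (balancedTransferMatrix_isHermitian (G₂ := G₂) 1 c)
  have hmem : i₀ ∈ univ.filter fun i =>
      (balancedTransferMatrix_isHermitian (G₂ := G₂) 1 c).eigenvalues i =
        topEigenvalue (balancedTransferMatrix_isHermitian (G₂ := G₂) 1 c) := by simp [hi₀]
  exact_mod_cast Finset.card_pos.mpr ⟨i₀, hmem⟩

/-- **Theorem 26 (ii), positivity**: the spectral measures `μ_{X,X†,L}` and `μ_{Y†,Y,L}` are
positive measures: `c_j(X, X†) ≥ 0` and `c_j(Y†, Y) ≥ 0` for every atom (reflection symmetry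
`𝔬_{X†} = 𝔬_Xᵀ` makes the weights sums of squares). [cite: DKLM2026SixVertexGFF, Theorem 26 (ii)] -/
theorem spectralWeight_reflectObs_nonneg (c : ℝ) (hc : 0 < c)
    [Nonempty {κ : G₂ → Bool // IsBalancedCol κ}] {r' : ℕ}
    (X : (G₂ → Bool) → (Fin (r' + 1) → G₂ → Bool) → (Fin (r' + 1) → G₂ → Bool) → ℝ)
    (j : {κ : G₂ → Bool // IsBalancedCol κ}) :
    0 ≤ spectralWeight c X (reflectObs X) j ∧ 0 ≤ spectralWeight c (reflectObs X) X j := by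
  unfold spectralWeight
  rw [balObsMatrix_reflectObs]
  have hD := card_mul_topEigenvalue_pow_pos (G₂ := G₂) c hc (r' + 1 + (r' + 1))
  exact ⟨div_nonneg (pairSpectralWeight_transpose_nonneg _ _ j).1 hD.le,
    div_nonneg (pairSpectralWeight_transpose_nonneg _ _ j).2 hD.le⟩

/-- **Theorem 26 (ii), the Cauchy–Schwarz inequality**:
`‖μ_{X,Y,L}‖² ≤ ‖μ_{X,X†,L}‖ · ‖μ_{Y†,Y,L}‖`, i.e.
`(∑_j |c_j(X,Y)|)² ≤ (∑_j c_j(X,X†)) (∑_j c_j(Y†,Y))` — and by Theorem 26 (i) with `k = 0` the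
right-hand side is `𝔼_{CYL_L}[X X†] 𝔼_{CYL_L}[Y† Y]`. [cite: DKLM2026SixVertexGFF, Theorem 26 (ii)] -/
theorem sq_sum_abs_spectralWeight_le (c : ℝ) (hc : 0 < c)
    [Nonempty {κ : G₂ → Bool // IsBalancedCol κ}] {r₁' r₂' : ℕ}
    (X : (G₂ → Bool) → (Fin (r₁' + 1) → G₂ → Bool) → (Fin (r₁' + 1) → G₂ → Bool) → ℝ)
    (Y : (G₂ → Bool) → (Fin (r₂' + 1) → G₂ → Bool) → (Fin (r₂' + 1) → G₂ → Bool) → ℝ) :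
    (∑ j, |spectralWeight c X Y j|) ^ 2 ≤
      (∑ j, spectralWeight c X (reflectObs X) j) * ∑ j, spectralWeight c (reflectObs Y) Y j := by
  have key := sq_sum_abs_pairSpectralWeight_le (balancedTransferMatrix_isHermitian (G₂ := G₂) 1 c)
    (balObsMatrix 1 1 c r₁' X) (balObsMatrix 1 1 c r₂' Y)
  have hD := card_mul_topEigenvalue_pow_pos (G₂ := G₂) c hc (r₁' + 1 + (r₂' + 1))
  have hD₁ := card_mul_topEigenvalue_pow_pos (G₂ := G₂) c hc (r₁' + 1 + (r₁' + 1))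
  have hD₂ := card_mul_topEigenvalue_pow_pos (G₂ := G₂) c hc (r₂' + 1 + (r₂' + 1))
  simp only [spectralWeight, balObsMatrix_reflectObs, abs_div, abs_of_pos hD, ← Finset.sum_div]
  rw [div_pow, div_mul_div_comm]
  have hDD : (((univ.filter fun i => (balancedTransferMatrix_isHermitian (G₂ := G₂) 1 c).eigenvalues i =
          topEigenvalue (balancedTransferMatrix_isHermitian (G₂ := G₂) 1 c)).card : ℝ) *
        topEigenvalue (balancedTransferMatrix_isHermitian (G₂ := G₂) 1 c) ^ (r₁' + 1 + (r₂' + 1))) ^ 2 =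
      (((univ.filter fun i => (balancedTransferMatrix_isHermitian (G₂ := G₂) 1 c).eigenvalues i =
          topEigenvalue (balancedTransferMatrix_isHermitian (G₂ := G₂) 1 c)).card : ℝ) *
        topEigenvalue (balancedTransferMatrix_isHermitian (G₂ := G₂) 1 c) ^ (r₁' + 1 + (r₁' + 1))) *
      (((univ.filter fun i => (balancedTransferMatrix_isHermitian (G₂ := G₂) 1 c).eigenvalues i =
          topEigenvalue (balancedTransferMatrix_isHermitian (G₂ := G₂) 1 c)).card : ℝ) *
        topEigenvalue (balancedTransferMatrix_isHermitian (G₂ := G₂) 1 c) ^ (r₂' + 1 + (r₂' + 1))) := by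
    ring
  rw [hDD]
  exact div_le_div_of_nonneg_right key (mul_pos hD₁ hD₂).le

/-- **Theorem 26 (ii), first inequality**: `|𝔼_{CYL_L}[X Y]| ≤ ‖μ_{X,Y,L}‖`, i.e.
`|∑_j c_j(X,Y)| ≤ ∑_j |c_j(X,Y)|`. [cite: DKLM2026SixVertexGFF, Theorem 26 (ii)] -/
theorem abs_sum_spectralWeight_le (c : ℝ) [Nonempty {κ : G₂ → Bool // IsBalancedCol κ}]
    {r₁' r₂' : ℕ}
    (X : (G₂ → Bool) → (Fin (r₁' + 1) → G₂ → Bool) → (Fin (r₁' + 1) → G₂ → Bool) → ℝ)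
    (Y : (G₂ → Bool) → (Fin (r₂' + 1) → G₂ → Bool) → (Fin (r₂' + 1) → G₂ → Bool) → ℝ) :
    |∑ j, spectralWeight c X Y j| ≤ ∑ j, |spectralWeight c X Y j| :=
  Finset.abs_sum_le_sum_abs _ _

/-- **Theorem 26 at `k = 0`**: `𝔼_{CYL_L}[X Y] = ∑_j c_j(X,Y) = μ_{X,Y,L}([0,2))` (the total mass),
in particular `𝔼_{CYL_L}[X X†] = ‖μ_{X,X†,L}‖`. [cite: DKLM2026SixVertexGFF, Theorem 26 (i)–(ii)] -/
theorem cylinderPairExp_eq_sum_zero (c : ℝ) (hc : 0 < c)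
    [Nonempty {κ : G₂ → Bool // IsBalancedCol κ}] {r₁' r₂' : ℕ}
    (X : (G₂ → Bool) → (Fin (r₁' + 1) → G₂ → Bool) → (Fin (r₁' + 1) → G₂ → Bool) → ℝ)
    (Y : (G₂ → Bool) → (Fin (r₂' + 1) → G₂ → Bool) → (Fin (r₂' + 1) → G₂ → Bool) → ℝ) :
    cylinderPairExp c r₁' X (r₁' + 1) r₂' Y = ∑ j, spectralWeight c X Y j := by
  simpa using cylinderPairExp_eq_sum c hc X Y 0

end TorusObs

end Literature.Probability.LatticeModels.SixVertex

end
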